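import Summits.Ventures.WeilGRH.FlatWindowArchCost
import HarnessLib

/-!
# GRH arm (rh-explicit, venture WeilGRH): the archimedean cost of the flat window EXACTLY —
  `I_κ(a) = Σ_{m≥0} (1 − e^{−2a(2m+½+κ)})/(2m+½+κ)²`, hence `T_κ(1 − e^{−(1+2κ)a}) ≤ I_κ(a) ≤ T_κ`,
  `T_κ = Σ_{m≥0} (2m+½+κ)⁻²` (`= ψ′(¼)/4 = 4.2993…`, `ψ′(¾)/4 = 0.6354…`)

Cell `rh-explicit`, WEIL TRACK (structure seat weil-3, gen9).  Sequel of `FlatWindowArchCost.lean` (gen8: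
`I₀(a) ≤ 4.361`, `I₁(a) ≤ 0.651`).  The archimedean cost `I_κ(a) = ∫₀^∞ ρ_κ(t) min(t, 2a) dt` of the
flat-window inequality / identity (`TwistedFlatTest`, `FlatWindowSpectral`) in closed form: with
`ρ_κ(t) = e^{(1/2−κ)t}/(2 sinh t) = Σ_m e^{−(2m+½+κ)t}` and `∫₀^∞ e^{−lt} min(t,2a) dt = (1 − e^{−2al})/l²`,

* `integral_exp_neg_mul_min`: the termwise integral;
* `sum_le_integral_weilArchDensityPar_mul_min`, `integral_weilArchDensityPar_mul_min_le_sum`: two-sided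
  partial-sum bounds (remainder `≤ 1/l′_M² + 1/(2l′_M)`, `l′_M = 2M+½+κ`, from `WeilArchDensityMoments`);
* **`hasSum_integral_weilArchDensityPar_mul_min`**, `integral_weilArchDensityPar_mul_min_eq_tsum`:
  `I_κ(a) = Σ_m (1 − e^{−2a(2m+½+κ)})/(2m+½+κ)²`;
* **`archConst_sub_integral_mem`**, `integral_weilArchDensityPar_mul_min_mem`:
  `0 ≤ T_κ − I_κ(a) = Σ_m e^{−2a(2m+½+κ)}/(2m+½+κ)² ≤ e^{−(1+2κ)a}·T_κ`;
* `archConst_bounds`: `4.2 ≤ T₀ ≤ 4.361`, `0.57 ≤ T₁ ≤ 0.651`.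

So in the flat-window asymptotics of `FlatWindowSpectral.lean` the `1/a` term is IDENTIFIED:
`2S_χ(a) + 2a·μ{0} = log q − K_κ + T_κ/a − Z′(a) − E(a)` with `0 ≤ Z′(a) ≤ (2/a)∫t⁻²dμ` (zeros) and
`0 ≤ E(a) ≤ e^{−(1+2κ)a}T_κ/a` (archimedean defect) — for even characters the slow approach to the limit
seen numerically (`χ₅`: gap `0.72` at `a = 6`) is `T₀/a = 4.30/6 = 0.717`, not zeros.

No definitions, no named facts, RH/GRH-free.

## References

* E. Bombieri, *Remarks on Weil's quadratic functional in the theory of prime numbers I*, Rend. Mat. Acc.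
  Lincei (9) 11 (2000) 183–233, Thm. 2 (the archimedean density). [Bombieri2000Weil]
-/

set_option autoImplicit false

noncomputable section

open Filter Set MeasureTheory
open scoped Real Topology

namespace Summit.Ventures.WeilGRH

open Literature.NumberTheory.LFunctions

variable {a : ℝ}

/-! ## The parity-`κ` density as `e^{−κt}ρ₀` and the termwise integral -/

/-- `ρ_κ(t) = e^{−κt} ρ₀(t)`. -/
theorem weilArchDensityPar_eq_exp_mul (κ : ℕ) (t : ℝ) :
    weilArchDensityPar κ t = Real.exp (-((κ : ℝ) * t)) * weilArchDensity t := by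
  unfold weilArchDensityPar weilArchDensity
  rw [show ((1 : ℝ) / 2 - (κ : ℝ)) * t = -((κ : ℝ) * t) + t / 2 by ring, Real.exp_add]
  ring

/-- `t ↦ e^{−lt} min(t, 2a)` is integrable on `(0, ∞)` (`l > 0`, `a ≥ 0`; dominated by `t e^{−lt}`). -/
theorem integrableOn_exp_neg_mul_min {l : ℝ} (hl : 0 < l) (ha : 0 ≤ a) :
    IntegrableOn (fun t : ℝ ↦ Real.exp (-(l * t)) * min t (2 * a)) (Ioi 0) := by
  refine (integrableOn_mul_exp_neg_mul_Ioi hl).mono' ?_ ?_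
  · exact ((by fun_prop : Continuous fun t : ℝ ↦ Real.exp (-(l * t)) * min t (2 * a)).measurable).aestronglyMeasurable
  · refine (ae_restrict_iff' measurableSet_Ioi).2 (Eventually.of_forall fun t (ht : 0 < t) ↦ ?_)
    rw [Real.norm_eq_abs, abs_mul, abs_of_pos (Real.exp_pos _)]
    have hm : |min t (2 * a)| ≤ t := by
      rcases le_or_gt t (2 * a) with h | h
      · rw [min_eq_left h, abs_of_pos ht]
      · rw [min_eq_right h.le, abs_le]; constructor <;> linarith
    calc Real.exp (-(l * t)) * |min t (2 * a)| ≤ Real.exp (-(l * t)) * t :=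
          mul_le_mul_of_nonneg_left hm (Real.exp_pos _).le
      _ = t * Real.exp (-(l * t)) := mul_comm _ _

/-- **The termwise integral**: `∫₀^∞ e^{−lt} min(t, 2a) dt = (1 − e^{−2al})/l²` (`l > 0`, `a ≥ 0`):
`∫₀^{2a} t e^{−lt} = 1/l² − e^{−2al}(2a/l + 1/l²)` plus `2a ∫_{2a}^∞ e^{−lt} = 2a e^{−2al}/l`. -/
theorem integral_exp_neg_mul_min {l : ℝ} (hl : 0 < l) (ha : 0 ≤ a) :
    ∫ t in Ioi (0 : ℝ), Real.exp (-(l * t)) * min t (2 * a) = (1 - Real.exp (-(2 * a * l))) / l ^ 2 := by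
  have hf := integrableOn_exp_neg_mul_min hl ha
  have h2a : (0 : ℝ) ≤ 2 * a := by linarith
  have hdisj : Disjoint (Ioc (0 : ℝ) (2 * a)) (Ioi (2 * a)) :=
    Set.disjoint_left.2 fun x hx hx' ↦ (not_lt.2 hx.2) hx'
  rw [← Ioc_union_Ioi_eq_Ioi h2a, setIntegral_union hdisj measurableSet_Ioi (hf.mono_set Ioc_subset_Ioi_self)
    (hf.mono_set (Ioi_subset_Ioi h2a))]
  -- the bulk `∫_{(0,2a]} t e^{−lt}`
  have hbulk : ∫ t in Ioc 0 (2 * a), Real.exp (-(l * t)) * min t (2 * a) =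
      1 / l ^ 2 - Real.exp (-(l * (2 * a))) * (1 / l ^ 2 + 2 * a / l) := by
    rw [setIntegral_congr_fun measurableSet_Ioc (fun t ht ↦ by rw [min_eq_left ht.2] :
        ∀ t ∈ Ioc (0 : ℝ) (2 * a), Real.exp (-(l * t)) * min t (2 * a) = Real.exp (-(l * t)) * t),
      ← intervalIntegral.integral_of_le h2a]
    have h := integral_pow_mul_exp_neg_mul 1 hl.ne' (2 * a)
    simp only [pow_one, Nat.factorial_one, Nat.cast_one] at h
    rw [show (fun t : ℝ ↦ Real.exp (-(l * t)) * t) = fun t ↦ t * Real.exp (-(l * t)) from funext fun t ↦ mul_comm _ _]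
    rw [h, incGammaPoly]
    simp [Finset.sum_range_succ]
  -- the tail `2a ∫_{2a}^∞ e^{−lt}`
  have htail : ∫ t in Ioi (2 * a), Real.exp (-(l * t)) * min t (2 * a) = 2 * a * (Real.exp (-(l * (2 * a))) / l) := by
    rw [setIntegral_congr_fun measurableSet_Ioi (fun t (ht : 2 * a < t) ↦ by rw [min_eq_right ht.le, mul_comm] :
        ∀ t ∈ Ioi (2 * a), Real.exp (-(l * t)) * min t (2 * a) = 2 * a * Real.exp (-(l * t))),
      integral_const_mul]
    have h := integral_exp_mul_Ioi (a := -l) (by linarith) (2 * a)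
    simp only [neg_mul] at h
    rw [h]
    field_simp
  rw [hbulk, htail, show -(2 * a * l) = -(l * (2 * a)) by ring]
  field_simp
  ring

/-! ## Two-sided partial-sum bounds for `I_κ(a) = ∫₀^∞ ρ_κ(t) min(t, 2a) dt` -/

/-- `t ↦ ρ_κ(t) min(t, 2a)` is integrable on `(0, ∞)` (dominated by `tρ₀ ≤ e^{−t/2}(1+2t)/2`). -/
theorem integrableOn_weilArchDensityPar_mul_min (κ : ℕ) (ha : 0 ≤ a) :
    IntegrableOn (fun t : ℝ ↦ weilArchDensityPar κ t * min t (2 * a)) (Ioi 0) := by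
  refine integrableOn_flatWindow_archMajorant.mono' ?_ ?_
  · exact ((measurable_weilArchDensityPar κ).mul
      (by fun_prop : Continuous fun t : ℝ ↦ min t (2 * a)).measurable).aestronglyMeasurable
  · refine (ae_restrict_iff' measurableSet_Ioi).2 (Eventually.of_forall fun t (ht : 0 < t) ↦ ?_)
    obtain ⟨h0, hle⟩ := weilArchDensityPar_nonneg_le κ ht
    have hm0 : 0 ≤ min t (2 * a) := le_min ht.le (by linarith)
    rw [Real.norm_eq_abs, abs_of_nonneg (mul_nonneg h0 hm0)]
    calc weilArchDensityPar κ t * min t (2 * a) ≤ weilArchDensity t * t :=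
          mul_le_mul hle (min_le_left _ _) hm0 (weilArchDensity_pos ht).le
      _ = t * weilArchDensity t := mul_comm _ _
      _ ≤ _ := mul_weilArchDensity_le ht

/-- The finite exponential split of `ρ_κ(t) min(t,2a)` for `t > 0`:
`ρ_κ(t)min(t,2a) = Σ_{m<M} e^{−(2m+½+κ)t} min(t,2a) + e^{−κt} rem_M(t) min(t,2a)`. -/
theorem weilArchDensityPar_mul_min_eq_sum_add {t : ℝ} (ht : 0 < t) (κ M : ℕ) (a : ℝ) :
    weilArchDensityPar κ t * min t (2 * a) =
      (∑ m ∈ Finset.range M, Real.exp (-((2 * m + 1 / 2 + κ) * t)) * min t (2 * a)) +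
        Real.exp (-((κ : ℝ) * t)) * weilArchDensityRem M t * min t (2 * a) := by
  rw [weilArchDensityPar_eq_exp_mul, weilArchDensity_eq_sum_add_rem ht M, mul_add, add_mul, Finset.mul_sum,
    Finset.sum_mul]
  congr 1
  refine Finset.sum_congr rfl fun m _ ↦ ?_
  rw [← Real.exp_add]
  congr 2
  ring

/-- **Lower partial-sum bound**: `Σ_{m<M} (1 − e^{−2a l_m})/l_m² ≤ I_κ(a)`, `l_m = 2m + ½ + κ` (`a ≥ 0`). -/
theorem sum_le_integral_weilArchDensityPar_mul_min (κ : ℕ) (ha : 0 ≤ a) (M : ℕ) :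
    ∑ m ∈ Finset.range M, (1 - Real.exp (-(2 * a * (2 * m + 1 / 2 + κ)))) / (2 * m + 1 / 2 + κ) ^ 2 ≤
      ∫ t in Ioi (0 : ℝ), weilArchDensityPar κ t * min t (2 * a) := by
  have hl : ∀ m : ℕ, (0 : ℝ) < 2 * m + 1 / 2 + κ := fun m ↦ by positivity
  have hterm : ∀ m ∈ Finset.range M, IntegrableOn
      (fun t : ℝ ↦ Real.exp (-((2 * m + 1 / 2 + κ) * t)) * min t (2 * a)) (Ioi 0) :=
    fun m _ ↦ integrableOn_exp_neg_mul_min (hl m) ha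
  calc ∑ m ∈ Finset.range M, (1 - Real.exp (-(2 * a * (2 * m + 1 / 2 + κ)))) / (2 * m + 1 / 2 + κ) ^ 2
      = ∑ m ∈ Finset.range M, ∫ t in Ioi (0 : ℝ), Real.exp (-((2 * m + 1 / 2 + κ) * t)) * min t (2 * a) :=
        Finset.sum_congr rfl fun m _ ↦ (integral_exp_neg_mul_min (hl m) ha).symm
    _ = ∫ t in Ioi (0 : ℝ), ∑ m ∈ Finset.range M, Real.exp (-((2 * m + 1 / 2 + κ) * t)) * min t (2 * a) :=
        (integral_finsetSum _ hterm).symm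
    _ ≤ ∫ t in Ioi (0 : ℝ), weilArchDensityPar κ t * min t (2 * a) := by
        refine setIntegral_mono_on (integrable_finsetSum _ hterm)
          (integrableOn_weilArchDensityPar_mul_min κ ha) measurableSet_Ioi fun t (ht : 0 < t) ↦ ?_
        rw [weilArchDensityPar_mul_min_eq_sum_add ht κ M a]
        have hrem : 0 ≤ Real.exp (-((κ : ℝ) * t)) * weilArchDensityRem M t * min t (2 * a) :=
          mul_nonneg (mul_nonneg (Real.exp_pos _).le (weilArchDensityRem_nonneg ht M)) (le_min ht.le (by linarith))
        linarith

/-- **Upper partial-sum bound**: `I_κ(a) ≤ Σ_{m<M} (1 − e^{−2a l_m})/l_m² + 1/l′_M² + 1/(2l′_M)` with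
`l′_M = 2M + ½ + κ` (`a ≥ 0`; remainder `e^{−κt}rem_M(t) min(t,2a) ≤ e^{−l′_M t}(t + ½)`). -/
theorem integral_weilArchDensityPar_mul_min_le_sum (κ : ℕ) (ha : 0 ≤ a) (M : ℕ) :
    ∫ t in Ioi (0 : ℝ), weilArchDensityPar κ t * min t (2 * a) ≤
      (∑ m ∈ Finset.range M, (1 - Real.exp (-(2 * a * (2 * m + 1 / 2 + κ)))) / (2 * m + 1 / 2 + κ) ^ 2) +
        (1 / (2 * M + 1 / 2 + κ) ^ 2 + 1 / (2 * (2 * M + 1 / 2 + κ))) := by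
  have hl : ∀ m : ℕ, (0 : ℝ) < 2 * m + 1 / 2 + κ := fun m ↦ by positivity
  set L : ℝ := 2 * M + 1 / 2 + κ with hL
  have hL0 : 0 < L := hl M
  have hterm : ∀ m ∈ Finset.range M, IntegrableOn
      (fun t : ℝ ↦ Real.exp (-((2 * m + 1 / 2 + κ) * t)) * min t (2 * a)) (Ioi 0) :=
    fun m _ ↦ integrableOn_exp_neg_mul_min (hl m) ha
  have hS : IntegrableOn (fun t : ℝ ↦ ∑ m ∈ Finset.range M,
      Real.exp (-((2 * m + 1 / 2 + κ) * t)) * min t (2 * a)) (Ioi 0) := integrable_finsetSum _ hterm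
  have hR1 := integrableOn_mul_exp_neg_mul_Ioi hL0
  have hR2 := integrableOn_exp_neg_mul_div_two hL0
  have hR : IntegrableOn (fun t : ℝ ↦ t * Real.exp (-(L * t)) + Real.exp (-(L * t)) / 2) (Ioi 0) := hR1.add hR2
  have hval : ∫ t in Ioi (0 : ℝ), ((∑ m ∈ Finset.range M, Real.exp (-((2 * m + 1 / 2 + κ) * t)) * min t (2 * a)) +
      (t * Real.exp (-(L * t)) + Real.exp (-(L * t)) / 2)) =
      (∑ m ∈ Finset.range M, (1 - Real.exp (-(2 * a * (2 * m + 1 / 2 + κ)))) / (2 * m + 1 / 2 + κ) ^ 2) +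
        (1 / L ^ 2 + 1 / (2 * L)) := by
    rw [integral_add hS hR, integral_finsetSum _ hterm, integral_add hR1 hR2, integral_mul_exp_neg_mul_Ioi hL0,
      integral_exp_neg_mul_div_two_Ioi hL0]
    congr 1
    exact Finset.sum_congr rfl fun m _ ↦ integral_exp_neg_mul_min (hl m) ha
  rw [← hval]
  refine setIntegral_mono_on (integrableOn_weilArchDensityPar_mul_min κ ha) (hS.add hR) measurableSet_Ioi
    fun t (ht : 0 < t) ↦ ?_
  rw [weilArchDensityPar_mul_min_eq_sum_add ht κ M a]
  -- the remainder: `e^{−κt} rem_M(t) min(t,2a) ≤ e^{−L t}(1 + 1/(2t)) t = t e^{−Lt} + e^{−Lt}/2`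
  have hrem := weilArchDensityRem_le ht M
  have hrem0 := weilArchDensityRem_nonneg ht M
  have hm0 : 0 ≤ min t (2 * a) := le_min ht.le (by linarith)
  have hmt : min t (2 * a) ≤ t := min_le_left _ _
  have hexp : Real.exp (-((κ : ℝ) * t)) * Real.exp (-((2 * M + 1 / 2) * t)) = Real.exp (-(L * t)) := by
    rw [← Real.exp_add, hL]; congr 1; ring
  have key : Real.exp (-((κ : ℝ) * t)) * weilArchDensityRem M t * min t (2 * a) ≤
      t * Real.exp (-(L * t)) + Real.exp (-(L * t)) / 2 := by
    calc Real.exp (-((κ : ℝ) * t)) * weilArchDensityRem M t * min t (2 * a)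
        ≤ Real.exp (-((κ : ℝ) * t)) * (Real.exp (-((2 * M + 1 / 2) * t)) * (1 + 1 / (2 * t))) * t := by
          refine mul_le_mul (mul_le_mul_of_nonneg_left hrem (Real.exp_pos _).le) hmt hm0 ?_
          exact mul_nonneg (Real.exp_pos _).le ((weilArchDensityRem_nonneg ht M).trans hrem)
      _ = Real.exp (-(L * t)) * (t + 1 / 2) := by
          rw [← hexp]; field_simp
      _ = t * Real.exp (-(L * t)) + Real.exp (-(L * t)) / 2 := by ring
  linarith

/-! ## The exact series and the exponentially small defect -/

/-- **`I_κ(a)` AS A SERIES**: `HasSum (m ↦ (1 − e^{−2a(2m+½+κ)})/(2m+½+κ)²) (∫₀^∞ ρ_κ(t) min(t,2a) dt)`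
(`a ≥ 0`; squeeze between the two partial-sum bounds, the remainder `1/l′_M² + 1/(2l′_M) → 0`). -/
theorem hasSum_integral_weilArchDensityPar_mul_min (κ : ℕ) (ha : 0 ≤ a) :
    HasSum (fun m : ℕ ↦ (1 - Real.exp (-(2 * a * (2 * m + 1 / 2 + κ)))) / (2 * m + 1 / 2 + κ) ^ 2)
      (∫ t in Ioi (0 : ℝ), weilArchDensityPar κ t * min t (2 * a)) := by
  set I := ∫ t in Ioi (0 : ℝ), weilArchDensityPar κ t * min t (2 * a) with hI
  set f : ℕ → ℝ := fun m ↦ (1 - Real.exp (-(2 * a * (2 * m + 1 / 2 + κ)))) / (2 * m + 1 / 2 + κ) ^ 2 with hf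
  have hf0 : ∀ m, 0 ≤ f m := fun m ↦ by
    have : Real.exp (-(2 * a * (2 * m + 1 / 2 + κ))) ≤ 1 := Real.exp_le_one_iff.2 (by
      have : (0 : ℝ) ≤ 2 * a * (2 * m + 1 / 2 + κ) := by positivity
      linarith)
    exact div_nonneg (by linarith) (by positivity)
  rw [hasSum_iff_tendsto_nat_of_nonneg hf0]
  -- the remainder tends to `0`
  have hL : Tendsto (fun M : ℕ ↦ (2 * (M : ℝ) + 1 / 2 + κ)) atTop atTop :=
    tendsto_atTop_add_const_right _ _ (tendsto_atTop_add_const_right _ _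
      (tendsto_natCast_atTop_atTop.const_mul_atTop two_pos))
  have hε : Tendsto (fun M : ℕ ↦ 1 / (2 * (M : ℝ) + 1 / 2 + κ) ^ 2 + 1 / (2 * (2 * (M : ℝ) + 1 / 2 + κ))) atTop
      (𝓝 0) := by
    have h1 : Tendsto (fun M : ℕ ↦ 1 / (2 * (M : ℝ) + 1 / 2 + κ) ^ 2) atTop (𝓝 0) :=
      (((tendsto_pow_atTop two_ne_zero).comp hL).inv_tendsto_atTop).congr fun M ↦ by
        simp only [Pi.inv_apply, Function.comp_apply, one_div]
    have h2 : Tendsto (fun M : ℕ ↦ 1 / (2 * (2 * (M : ℝ) + 1 / 2 + κ))) atTop (𝓝 0) :=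
      ((hL.const_mul_atTop two_pos).inv_tendsto_atTop).congr fun M ↦ by simp only [Pi.inv_apply, one_div]
    have h12 := h1.add h2
    rw [add_zero] at h12
    exact h12
  refine tendsto_of_tendsto_of_tendsto_of_le_of_le (f := fun n ↦ ∑ i ∈ Finset.range n, f i)
    (g := fun M ↦ I - (1 / (2 * (M : ℝ) + 1 / 2 + κ) ^ 2 + 1 / (2 * (2 * (M : ℝ) + 1 / 2 + κ))))
    (h := fun _ ↦ I) ?_ tendsto_const_nhds (fun M ↦ ?_) (fun M ↦ ?_)
  · simpa using tendsto_const_nhds.sub hε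
  · have h := integral_weilArchDensityPar_mul_min_le_sum κ ha M
    simp only [hf]
    linarith
  · exact sum_le_integral_weilArchDensityPar_mul_min κ ha M

/-- **`I_κ(a) = Σ_m (1 − e^{−2a(2m+½+κ)})/(2m+½+κ)²`** (`a ≥ 0`). -/
theorem integral_weilArchDensityPar_mul_min_eq_tsum (κ : ℕ) (ha : 0 ≤ a) :
    ∫ t in Ioi (0 : ℝ), weilArchDensityPar κ t * min t (2 * a) =
      ∑' m : ℕ, (1 - Real.exp (-(2 * a * (2 * m + 1 / 2 + κ)))) / (2 * m + 1 / 2 + κ) ^ 2 :=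
  (hasSum_integral_weilArchDensityPar_mul_min κ ha).tsum_eq.symm

/-- The constants `T_κ = Σ_m (2m+½+κ)⁻²` converge (comparison with `Σ 1/m²`). -/
theorem summable_inv_sq_arch (κ : ℕ) : Summable fun m : ℕ ↦ 1 / (2 * (m : ℝ) + 1 / 2 + κ) ^ 2 := by
  have hg : Summable fun m : ℕ ↦ 1 / (m : ℝ) ^ 2 := Real.summable_one_div_nat_pow.2 one_lt_two
  refine Summable.of_norm_bounded_eventually hg ?_
  rw [Nat.cofinite_eq_atTop]
  filter_upwards [eventually_ge_atTop 1] with m hm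
  have hm1 : (1 : ℝ) ≤ m := by exact_mod_cast hm
  rw [Real.norm_of_nonneg (by positivity)]
  exact one_div_le_one_div_of_le (by positivity) (by nlinarith [(κ.cast_nonneg : (0 : ℝ) ≤ κ)])

/-- **The defect is a series of exponentials**: `T_κ − I_κ(a) = Σ_m e^{−2a(2m+½+κ)}/(2m+½+κ)²` (`a ≥ 0`). -/
theorem hasSum_archConst_sub_integral (κ : ℕ) (ha : 0 ≤ a) :
    HasSum (fun m : ℕ ↦ Real.exp (-(2 * a * (2 * m + 1 / 2 + κ))) / (2 * m + 1 / 2 + κ) ^ 2)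
      ((∑' m : ℕ, 1 / (2 * (m : ℝ) + 1 / 2 + κ) ^ 2) - ∫ t in Ioi (0 : ℝ), weilArchDensityPar κ t * min t (2 * a)) := by
  have h := (summable_inv_sq_arch κ).hasSum.sub (hasSum_integral_weilArchDensityPar_mul_min κ ha)
  refine h.congr_fun fun m ↦ ?_
  show _ = 1 / (2 * (m : ℝ) + 1 / 2 + κ) ^ 2 - (1 - Real.exp (-(2 * a * (2 * m + 1 / 2 + κ)))) / (2 * m + 1 / 2 + κ) ^ 2
  have : (0 : ℝ) < (2 * m + 1 / 2 + κ) ^ 2 := by positivity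
  field_simp
  ring

/-- **TWO-SIDED: `0 ≤ T_κ − I_κ(a) ≤ e^{−(1+2κ)a} T_κ`** (`a ≥ 0`): the archimedean cost of the flat window
is its limit `T_κ = Σ_m (2m+½+κ)⁻²` (`= ψ′(¼)/4 = 4.2993…` for `κ = 0`, `ψ′(¾)/4 = 0.6354…` for `κ = 1`)
up to an EXPONENTIALLY small defect. -/
theorem archConst_sub_integral_mem (κ : ℕ) (ha : 0 ≤ a) :
    0 ≤ (∑' m : ℕ, 1 / (2 * (m : ℝ) + 1 / 2 + κ) ^ 2) - ∫ t in Ioi (0 : ℝ), weilArchDensityPar κ t * min t (2 * a) ∧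
      (∑' m : ℕ, 1 / (2 * (m : ℝ) + 1 / 2 + κ) ^ 2) - ∫ t in Ioi (0 : ℝ), weilArchDensityPar κ t * min t (2 * a) ≤
        Real.exp (-((1 + 2 * κ) * a)) * ∑' m : ℕ, 1 / (2 * (m : ℝ) + 1 / 2 + κ) ^ 2 := by
  have h := hasSum_archConst_sub_integral κ ha
  have hT := summable_inv_sq_arch κ
  constructor
  · rw [← h.tsum_eq]; exact tsum_nonneg fun m ↦ by positivity
  · rw [← h.tsum_eq, ← tsum_mul_left]
    refine Summable.tsum_le_tsum (fun m ↦ ?_) h.summable (hT.mul_left _)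
    rw [mul_one_div, div_le_div_iff_of_pos_right (by positivity)]
    refine Real.exp_le_exp.2 ?_
    have h0 : (0 : ℝ) ≤ 2 * a * (2 * m) := by positivity
    nlinarith [(κ.cast_nonneg : (0 : ℝ) ≤ κ), (m.cast_nonneg : (0 : ℝ) ≤ m)]

/-- **`I_κ(a) ≤ T_κ`** and **`T_κ(1 − e^{−(1+2κ)a}) ≤ I_κ(a)`** (`a ≥ 0`). -/
theorem integral_weilArchDensityPar_mul_min_mem (κ : ℕ) (ha : 0 ≤ a) :
    (1 - Real.exp (-((1 + 2 * κ) * a))) * (∑' m : ℕ, 1 / (2 * (m : ℝ) + 1 / 2 + κ) ^ 2) ≤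
        ∫ t in Ioi (0 : ℝ), weilArchDensityPar κ t * min t (2 * a) ∧
      ∫ t in Ioi (0 : ℝ), weilArchDensityPar κ t * min t (2 * a) ≤ ∑' m : ℕ, 1 / (2 * (m : ℝ) + 1 / 2 + κ) ^ 2 := by
  obtain ⟨h0, h1⟩ := archConst_sub_integral_mem κ ha
  constructor <;> nlinarith

/-- **Numerical enclosure of the constants**: `4.2 ≤ T₀ ≤ 4.361` and `0.57 ≤ T₁ ≤ 0.651`
(partial sums below; `T_κ = lim I_κ(a) ≤` the bounds of `FlatWindowArchCost` above). -/
theorem archConst_bounds :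
    (4.2 : ℝ) ≤ ∑' m : ℕ, 1 / (2 * (m : ℝ) + 1 / 2 + (0 : ℕ)) ^ 2 ∧
      (∑' m : ℕ, 1 / (2 * (m : ℝ) + 1 / 2 + (0 : ℕ)) ^ 2) ≤ 4.361 ∧
    (0.57 : ℝ) ≤ ∑' m : ℕ, 1 / (2 * (m : ℝ) + 1 / 2 + (1 : ℕ)) ^ 2 ∧
      (∑' m : ℕ, 1 / (2 * (m : ℝ) + 1 / 2 + (1 : ℕ)) ^ 2) ≤ 0.651 := by
  have hT0 := summable_inv_sq_arch 0
  have hT1 := summable_inv_sq_arch 1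
  -- upper bounds: `T_κ ≤ I_κ(a) + e^{-(1+2κ)a} T_κ` with `a` large and `I_κ ≤ 4.361 / 0.651`
  have hup : ∀ κ : ℕ, ∀ B : ℝ, (∀ a : ℝ, 0 ≤ a → ∫ t in Ioi (0 : ℝ), weilArchDensityPar κ t * min t (2 * a) ≤ B) →
      (∑' m : ℕ, 1 / (2 * (m : ℝ) + 1 / 2 + κ) ^ 2) ≤ B := by
    intro κ B hB
    -- `T(1 − e^{−(1+2κ)a}) ≤ B` for all `a ≥ 0`; let `a → ∞`
    have hlim : Tendsto (fun a : ℝ ↦ (1 - Real.exp (-((1 + 2 * κ) * a))) *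
        ∑' m : ℕ, 1 / (2 * (m : ℝ) + 1 / 2 + κ) ^ 2) atTop (𝓝 ((1 - 0) * ∑' m : ℕ, 1 / (2 * (m : ℝ) + 1 / 2 + κ) ^ 2)) := by
      refine ((tendsto_const_nhds.sub ?_).mul tendsto_const_nhds)
      have : Tendsto (fun a : ℝ ↦ (1 + 2 * (κ : ℝ)) * a) atTop atTop :=
        tendsto_id.const_mul_atTop (by positivity)
      exact Real.tendsto_exp_neg_atTop_nhds_zero.comp this
    rw [sub_zero, one_mul] at hlim
    exact le_of_tendsto hlim (Filter.eventually_atTop.2 ⟨0, fun a ha ↦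
      (integral_weilArchDensityPar_mul_min_mem κ ha).1.trans (hB a ha)⟩)
  refine ⟨?_, hup 0 _ fun a ha ↦ integral_weilArchDensityPar_zero_mul_min_le ha, ?_,
    hup 1 _ fun a ha ↦ integral_weilArchDensityPar_one_mul_min_le ha⟩
  · refine le_trans ?_ (hT0.sum_le_tsum (Finset.range 3) (fun m _ ↦ by positivity))
    simp [Finset.sum_range_succ]
    norm_num
  · refine le_trans ?_ (hT1.sum_le_tsum (Finset.range 4) (fun m _ ↦ by positivity))
    simp [Finset.sum_range_succ]
    norm_num

end Summit.Ventures.WeilGRH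

end
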